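import Literature.Analysis.FluidPDE.Tao2016AveragedNS.SplitCascadeScaleOnePast
import Literature.Analysis.FluidPDE.TaoCascadeScaleOneSmall
import HarnessLib

/-!
# The split Prop. 6.5, Prop. 6.13, I: `c̃₁` under control of the rotor phase (the fresh shell's amplifier)

T. Tao, *Finite time blowup for an averaged three-dimensional Navier–Stokes equation*,
J. Amer. Math. Soc. 29 (2016), 601–674 (arXiv:1402.0290v3), §6.6 Prop. 6.13, (6.121)–(6.124), (6.89)–(6.91).
HONEST FRAMING: statements about the SPLIT cascade model system; nothing here proves the split
Prop. 6.5 and nothing here concerns the true Navier–Stokes equations.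

Split counterpart of `TaoCascadeScaleOneSmall.lean` (same lemma names under
`RescaledSplitHypotheses`). What changes, and ONLY this: the seed of the fresh shell's `c̃₁` is the
cross product `ε²e^{-K¹⁰}·2a′₁a″₁ = ε²e^{-K¹⁰}(ã₁² - Z̃²_{a,1})` — NOT sign-definite. Accordingly
* the source of the `c̃₁`-Grönwall ((6.122), `abs_c_one_le_exp_mul_integral`) is
  `R♯ = (1+ε₀)^{5/2}ε²e^{-K¹⁰}(ã₁² + Z̃²_{a,1}) + 4C₁(1+ε₀)^{-n₀/2}Ẽ₁^{1/2}`; over the past it obeys the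
  SAME bound as Tao's source (`ã₁² + Z̃²_{a,1} ≤ 2Ẽ₁`, `integral_source_one_past_le`); over the
  present the caller supplies `∫₀^T (ã₁² + Z̃²_{a,1}) ≤ P` (`integral_source_one_present_le`);
* the one-sided bound (6.91) (`c_one_ge_neg`) keeps the NEGATIVE part of the seed in its source:
  `c̃₁(t) ≥ -e^{(6/100)K¹⁰} ∫_{τ₀}^t (4C₁(1+ε₀)^{-n₀/2}Ẽ₁^{1/2} + (1+ε₀)^{5/2}ε²e^{-K¹⁰}Z̃²_{a,1})`. THIS IS
  THE ONE NON-MECHANICAL POINT OF THE PROP. 6.13 PORT: for the next checkpoint's (6.57)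
  `c ≥ -(1+ε₀)^{-n₀/4}` the integral `∫_{τ₀}^{T} Z̃²_{a,1}` (past AND present of the fresh shell) must be
  `n₀`-small, which the energy bound `Z̃² ≤ 2Ẽ₁` does NOT give (`2∫_{past}Ẽ₁ ≲ K⁻³⁰C₃` is `n₀`-free);
  it follows instead from a whole-past Grönwall on the rows (6.Z1)–(6.Z3) of the fresh shell
  (source `C₁(1+ε₀)^{2-n₀/2}Ẽ₁^{1/2}` summed over the past windows with the decay of `Ẽ₁`, as in
  `SplitCascadeScaleOnePast.lean`) — a separate lemma, not in this file.

## References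

* T. Tao, arXiv:1402.0290v3, §6.6 Prop. 6.13, (6.86), (6.89)–(6.95), (6.120)–(6.125).
  [`Tao2016AveragedNS`]
-/

noncomputable section

open Set MeasureTheory intervalIntegral Filter Topology
open Literature.Analysis.ODE

namespace Literature.Analysis.FluidPDE

namespace Tao2016AveragedNS

open TaoCascade

section ScaleOne

variable {γ ε₀ K ε C₁ C₂ C₃ : ℝ} {n₀ N : ℤ} {ηp : ℤ → ℝ} {βp : ℕ → ℝ} {τ : ℤ → ℝ}
  {Xr : Fin 4 → ℤ → ℝ → ℝ} {W : Fin 3 → ℤ → ℝ → ℝ} {Er : ℤ → ℝ → ℝ}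

/-- **(6.46) at `k = 1`** with the error written `4 C₁ (1+ε₀)^{-n₀/2} Ẽ₁^{1/2}`
(from `RescaledSplitHypotheses.eq_b_one` of `TaoCascadeFineModes.lean`). [cite: Tao2016AveragedNS, §6.4 Prop. 6.5 (6.46)] -/
theorem RescaledSplitHypotheses.eq_b_one_delta (h : RescaledSplitHypotheses γ ε₀ K ε C₁ C₂ C₃ n₀ N ηp βp τ Xr W Er)
    (hε₀ : 0 < ε₀) (hε₀1 : ε₀ ≤ 1) (hC₁ : 0 ≤ C₁) {t : ℝ} (ht : τ (n₀ - N) ≤ t) :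
    |derivWithin (Xr 1 1) (Ici (τ (n₀ - N))) t -
        (1 + ε₀) ^ ((5 : ℝ) / 2) * (ε * Xr 0 1 t ^ 2 - ε⁻¹ * K ^ 10 * Xr 2 1 t ^ 2 -
          ε * W 0 1 t ^ 2 + ε⁻¹ * K ^ 10 * W 1 1 t ^ 2)| ≤
      4 * C₁ * (1 + ε₀) ^ (-(n₀ : ℝ) / 2) * Real.sqrt (Er 1 t) :=
  (h.eq_b_one ht).trans (err_weight_one_le Er n₀ hε₀ hε₀1 hC₁ t)

/-- **(6.47) at `k = 1`** with the error written `4 C₁ (1+ε₀)^{-n₀/2} Ẽ₁^{1/2}`.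
[cite: Tao2016AveragedNS, §6.4 Prop. 6.5 (6.47)] -/
theorem RescaledSplitHypotheses.eq_c_one_delta (h : RescaledSplitHypotheses γ ε₀ K ε C₁ C₂ C₃ n₀ N ηp βp τ Xr W Er)
    (hε₀ : 0 < ε₀) (hε₀1 : ε₀ ≤ 1) (hC₁ : 0 ≤ C₁) {t : ℝ} (ht : τ (n₀ - N) ≤ t) :
    |derivWithin (Xr 2 1) (Ici (τ (n₀ - N))) t -
        (1 + ε₀) ^ ((5 : ℝ) / 2) *
          (ε ^ 2 * Real.exp (-K ^ 10) * Xr 0 1 t ^ 2 + ε⁻¹ * K ^ 10 * Xr 1 1 t * Xr 2 1 t -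
            ε ^ 2 * Real.exp (-K ^ 10) * W 0 1 t ^ 2)| ≤
      4 * C₁ * (1 + ε₀) ^ (-(n₀ : ℝ) / 2) * Real.sqrt (Er 1 t) :=
  (h.eq_c_one ht).trans (err_weight_one_le Er n₀ hε₀ hε₀1 hC₁ t)

/-- **(6.48) at `k = 1`** with the error written `4 C₁ (1+ε₀)^{-n₀/2} Ẽ₁^{1/2}`.
[cite: Tao2016AveragedNS, §6.4 Prop. 6.5 (6.48)] -/
theorem RescaledSplitHypotheses.eq_d_one_delta (h : RescaledSplitHypotheses γ ε₀ K ε C₁ C₂ C₃ n₀ N ηp βp τ Xr W Er)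
    (hε₀ : 0 < ε₀) (hε₀1 : ε₀ ≤ 1) (hC₁ : 0 ≤ C₁) {t : ℝ} (ht : τ (n₀ - N) ≤ t) :
    |derivWithin (Xr 3 1) (Ici (τ (n₀ - N))) t -
        (1 + ε₀) ^ ((5 : ℝ) / 2) * ((ε ^ 2)⁻¹ * Xr 2 1 t * Xr 0 1 t -
          (1 + ε₀) ^ ((5 : ℝ) / 2) * K * Xr 3 1 t * Xr 0 2 t - (ε ^ 2)⁻¹ * W 0 1 t * W 1 1 t)| ≤
      4 * C₁ * (1 + ε₀) ^ (-(n₀ : ℝ) / 2) * Real.sqrt (Er 1 t) :=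
  (h.eq_d_one ht).trans (err_weight_one_le Er n₀ hε₀ hε₀1 hC₁ t)

/-! ## (6.122): Grönwall for `c₁` under control of the rotor phase -/

/-- Continuity of the source `R = (1+ε₀)^{5/2} ε² e^{-K^{10}} a₁² + 4C₁(1+ε₀)^{-n₀/2} Ẽ₁^{1/2}` of the
`c₁`-equation on intervals past `τ₀`. [cite: Tao2016AveragedNS, §6.6 Prop. 6.13 (6.122)] -/
theorem RescaledSplitHypotheses.continuousOn_source_one
    (h : RescaledSplitHypotheses γ ε₀ K ε C₁ C₂ C₃ n₀ N ηp βp τ Xr W Er) {a b : ℝ} (ha : τ (n₀ - N) ≤ a) :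
    ContinuousOn (fun s => (1 + ε₀) ^ ((5 : ℝ) / 2) * ε ^ 2 * Real.exp (-K ^ 10) * (Xr 0 1 s ^ 2 + W 0 1 s ^ 2) +
      4 * C₁ * (1 + ε₀) ^ (-(n₀ : ℝ) / 2) * Real.sqrt (Er 1 s)) (Icc a b) :=
  (continuousOn_const.mul (((h.continuousOn_X 0 1 ha).pow 2).add ((h.continuousOn_W 0 1 ha).pow 2))).add
    (continuousOn_const.mul (h.continuousOn_E 1 ha).sqrt)

/-- **(6.122): Grönwall for `c₁` from `τ₀`.** Let `τ₀ ≤ T`. If the rotor phase obeys the bootstrap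
bound `Λ(t) = ∫_{τ₀}^t |b₁| ≤ ε/100` for `t ∈ [τ₀, T]` ((6.121) with `ε/100`), then for `t ∈ [τ₀, T]`:
`|c₁(t)| ≤ exp((6/100) K^{10}) · ∫_{τ₀}^t R`, with the source
`R = (1+ε₀)^{5/2} ε² e^{-K^{10}} a₁² + 4 C₁ (1+ε₀)^{-n₀/2} Ẽ₁^{1/2}` (recall `c₁(τ₀) = 0` by (6.50)).
[cite: Tao2016AveragedNS, §6.6 Prop. 6.13 (6.121)–(6.122)] -/
theorem RescaledSplitHypotheses.abs_c_one_le_exp_mul_integral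
    (h : RescaledSplitHypotheses γ ε₀ K ε C₁ C₂ C₃ n₀ N ηp βp τ Xr W Er) (hε₀ : 0 < ε₀) (hε₀1 : ε₀ < 1)
    (hε : 0 < ε) (hC₁ : 0 ≤ C₁) (hN : n₀ ≤ N) {T : ℝ}
    (hΛ : ∀ t ∈ Icc (τ (n₀ - N)) T, ∫ s in (τ (n₀ - N))..t, |Xr 1 1 s| ≤ ε / 100)
    {t : ℝ} (ht : t ∈ Icc (τ (n₀ - N)) T) :
    |Xr 2 1 t| ≤ Real.exp (6 / 100 * K ^ 10) *
      ∫ s in (τ (n₀ - N))..t, ((1 + ε₀) ^ ((5 : ℝ) / 2) * ε ^ 2 * Real.exp (-K ^ 10) * (Xr 0 1 s ^ 2 + W 0 1 s ^ 2) +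
        4 * C₁ * (1 + ε₀) ^ (-(n₀ : ℝ) / 2) * Real.sqrt (Er 1 s)) := by
  have h0 : (0 : ℝ) < 1 + ε₀ := by linarith
  have hq6 : (1 + ε₀) ^ ((5 : ℝ) / 2) ≤ 6 := rpow_five_halves_le_six h0.le (by linarith)
  -- the linear structure `|c₁' - β c₁| ≤ R`
  set β : ℝ → ℝ := fun s => (1 + ε₀) ^ ((5 : ℝ) / 2) * ε⁻¹ * K ^ 10 * Xr 1 1 s with hβ
  set R : ℝ → ℝ := fun s => (1 + ε₀) ^ ((5 : ℝ) / 2) * ε ^ 2 * Real.exp (-K ^ 10) * (Xr 0 1 s ^ 2 + W 0 1 s ^ 2) +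
      4 * C₁ * (1 + ε₀) ^ (-(n₀ : ℝ) / 2) * Real.sqrt (Er 1 s) with hR
  have hβc : ContinuousOn β (Icc (τ (n₀ - N)) T) := continuousOn_const.mul (h.continuousOn_X 1 1 le_rfl)
  have hRc : ContinuousOn R (Icc (τ (n₀ - N)) T) := h.continuousOn_source_one le_rfl
  have hR0 : ∀ s ∈ Icc (τ (n₀ - N)) T, 0 ≤ R s := fun s hs => by simp only [hR]; positivity
  have hbound : ∀ s ∈ Ico (τ (n₀ - N)) T,
      |derivWithin (Xr 2 1) (Ici (τ (n₀ - N))) s - β s * Xr 2 1 s| ≤ R s := by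
    intro s hs
    have hE := h.eq_c_one_delta hε₀ hε₀1.le hC₁ hs.1
    have hid : derivWithin (Xr 2 1) (Ici (τ (n₀ - N))) s - β s * Xr 2 1 s =
        (derivWithin (Xr 2 1) (Ici (τ (n₀ - N))) s - (1 + ε₀) ^ ((5 : ℝ) / 2) *
          (ε ^ 2 * Real.exp (-K ^ 10) * Xr 0 1 s ^ 2 + ε⁻¹ * K ^ 10 * Xr 1 1 s * Xr 2 1 s -
            ε ^ 2 * Real.exp (-K ^ 10) * W 0 1 s ^ 2)) +
        (1 + ε₀) ^ ((5 : ℝ) / 2) * ε ^ 2 * Real.exp (-K ^ 10) * (Xr 0 1 s ^ 2 - W 0 1 s ^ 2) := by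
      simp only [hβ]; ring
    rw [hid]
    refine (abs_add_le _ _).trans ?_
    simp only [hR]
    have hl : 0 ≤ (1 + ε₀) ^ ((5 : ℝ) / 2) * ε ^ 2 * Real.exp (-K ^ 10) := by positivity
    have hsw : |(1 + ε₀) ^ ((5 : ℝ) / 2) * ε ^ 2 * Real.exp (-K ^ 10) * (Xr 0 1 s ^ 2 - W 0 1 s ^ 2)| ≤
        (1 + ε₀) ^ ((5 : ℝ) / 2) * ε ^ 2 * Real.exp (-K ^ 10) * (Xr 0 1 s ^ 2 + W 0 1 s ^ 2) := by
      rw [abs_mul, abs_of_nonneg hl]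
      apply mul_le_mul_of_nonneg_left _ hl
      rw [abs_le]; constructor <;> nlinarith [sq_nonneg (Xr 0 1 s), sq_nonneg (W 0 1 s)]
    linarith
  have hmain := abs_le_linearComparison (h.continuousOn_X 2 1 le_rfl)
    (fun s hs => h.hasDeriv_X 2 1 hs.1) hRc hR0 hβc hbound ht
  have hinit : Xr 2 1 (τ (n₀ - N)) = 0 := h.init_Y 2 1 (by omega)
  rw [hinit, abs_zero, zero_add] at hmain
  -- the exponent: `∫|β| = q^{5/2} ε⁻¹ K^{10} Λ(t) ≤ (6/100) K^{10}`
  have hexp : Real.exp (∫ s in (τ (n₀ - N))..t, |β s|) ≤ Real.exp (6 / 100 * K ^ 10) := by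
    apply Real.exp_le_exp.2
    have hI : ∫ s in (τ (n₀ - N))..t, |β s| =
        (1 + ε₀) ^ ((5 : ℝ) / 2) * ε⁻¹ * K ^ 10 * ∫ s in (τ (n₀ - N))..t, |Xr 1 1 s| :=
      integral_abs_rate_eq K hε₀ hε (Xr 1 1) (τ (n₀ - N)) t
    rw [hI]
    have hΛt := hΛ t ht
    have hK10 : 0 ≤ K ^ 10 := by positivity
    calc (1 + ε₀) ^ ((5 : ℝ) / 2) * ε⁻¹ * K ^ 10 * ∫ s in (τ (n₀ - N))..t, |Xr 1 1 s|
        ≤ (1 + ε₀) ^ ((5 : ℝ) / 2) * ε⁻¹ * K ^ 10 * (ε / 100) :=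
          mul_le_mul_of_nonneg_left hΛt (by positivity)
      _ = (1 + ε₀) ^ ((5 : ℝ) / 2) * K ^ 10 / 100 := by field_simp
      _ ≤ 6 * K ^ 10 / 100 := by gcongr
      _ = 6 / 100 * K ^ 10 := by ring
  have hint0 : 0 ≤ ∫ s in (τ (n₀ - N))..t, R s := integral_nonneg ht.1 fun s hs => hR0 s ⟨hs.1, hs.2.trans ht.2⟩
  exact hmain.trans (mul_le_mul_of_nonneg_right hexp hint0)

/-! ## The source integral `∫ R` on the past and on the present -/

/-- **The source integral over the past**, on the `k`-th interval: for `n₀-N < k ≤ 0` and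
`τ_{k-1} ≤ t ≤ τ_k`, `∫_{τ₀}^t R ≤ (A_c + B_c)(1+ε₀)^{(496/100)k}` with
`A_c = 12 ε² e^{-K^{10}} K^{-30} C₃ geomConst ε₀ (747/100)` (from `a₁² ≤ 2Ẽ₁` and Lemma 6.7) and
`B_c = 4C₁(1+ε₀)^{-n₀/2} · Ξ C₃ geomConst ε₀ (496/100)` (from the improved decay `Ẽ₁^{1/2} ≤ Ξ(1+ε₀)^{(747/100)k}`).
[cite: Tao2016AveragedNS, §6.6 Prop. 6.13 (6.122)–(6.123)] -/
theorem RescaledSplitHypotheses.integral_source_one_past_le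
    (h : RescaledSplitHypotheses γ ε₀ K ε C₁ C₂ C₃ n₀ N ηp βp τ Xr W Er) (hε₀ : 0 < ε₀) (hε₀1 : ε₀ < 1)
    (hK : 1 ≤ K) (hε : 0 < ε) (hC₁ : 0 ≤ C₁) (hC₃ : 0 ≤ C₃)
    (hκ : 36 * Real.sqrt 2 * K * ((K ^ 15)⁻¹ * (1 + ε₀) ^ (-(999 : ℝ) / 100) * C₃ *
      geomConst ε₀ ((248 : ℝ) / 100)) ≤ 1)
    {k : ℤ} (hk : n₀ - N < k) (hk0 : k ≤ 0) {t : ℝ} (ht : t ∈ Icc (τ (k - 1)) (τ k)) :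
    ∫ s in (τ (n₀ - N))..t, ((1 + ε₀) ^ ((5 : ℝ) / 2) * ε ^ 2 * Real.exp (-K ^ 10) * (Xr 0 1 s ^ 2 + W 0 1 s ^ 2) +
        4 * C₁ * (1 + ε₀) ^ (-(n₀ : ℝ) / 2) * Real.sqrt (Er 1 s)) ≤
      (12 * ε ^ 2 * Real.exp (-K ^ 10) * ((K ^ 30)⁻¹ * C₃ * geomConst ε₀ ((747 : ℝ) / 100)) +
        4 * C₁ * (1 + ε₀) ^ (-(n₀ : ℝ) / 2) *
          (Real.exp 1 * (6 * Real.sqrt 2 * K) * cumEnergyConst ε₀ C₃ * C₃ *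
            geomConst ε₀ ((496 : ℝ) / 100))) * (1 + ε₀) ^ ((496 : ℝ) / 100 * k) := by
  have h0 : (0 : ℝ) < 1 + ε₀ := by linarith
  have h1 : (1 : ℝ) ≤ 1 + ε₀ := by linarith
  have hKpos : 0 < K := by linarith
  have hq6 : (1 + ε₀) ^ ((5 : ℝ) / 2) ≤ 6 := rpow_five_halves_le_six h0.le (by linarith)
  have hτt : (τ (n₀ - N)) ≤ t := (h.tau_init_le_tau (by omega) (by omega)).trans ht.1
  have htk : t ≤ τ k := ht.2
  have hk0' : τ k ≤ 0 := h.tau_le k (by omega) hk0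
  have hτk : (τ (n₀ - N)) ≤ τ k := h.tau_init_le_tau (by omega) hk0
  set Ξ := Real.exp 1 * (6 * Real.sqrt 2 * K) * cumEnergyConst ε₀ C₃ with hΞ
  have hΞ0 : 0 ≤ Ξ := by have := cumEnergyConst_nonneg hε₀ hC₃; positivity
  -- split the integrand
  have hc1 : ContinuousOn (fun s => Xr 0 1 s ^ 2 + W 0 1 s ^ 2) (Icc (τ (n₀ - N)) (τ k)) :=
    ((h.continuousOn_X 0 1 le_rfl).pow 2).add ((h.continuousOn_W 0 1 le_rfl).pow 2)
  have hc2 : ContinuousOn (fun s => Real.sqrt (Er 1 s)) (Icc (τ (n₀ - N)) (τ k)) := (h.continuousOn_E 1 le_rfl).sqrt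
  have hi1 : IntervalIntegrable (fun s => Xr 0 1 s ^ 2 + W 0 1 s ^ 2) volume (τ (n₀ - N)) t :=
    (hc1.mono (Icc_subset_Icc le_rfl htk)).intervalIntegrable_of_Icc hτt
  have hi2 : IntervalIntegrable (fun s => Real.sqrt (Er 1 s)) volume (τ (n₀ - N)) t :=
    (hc2.mono (Icc_subset_Icc le_rfl htk)).intervalIntegrable_of_Icc hτt
  rw [intervalIntegral.integral_add (hi1.const_mul _) (hi2.const_mul _),
    intervalIntegral.integral_const_mul, intervalIntegral.integral_const_mul]
  -- first piece: `∫ a₁² ≤ 2 ∫ Ẽ₁ ≤ 2 K^{-30} C₃ G q^{(747/100)k} ≤ 2 K^{-30} C₃ G q^{(496/100)k}`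
  have hP1 : ∫ s in (τ (n₀ - N))..t, (Xr 0 1 s ^ 2 + W 0 1 s ^ 2) ≤
      2 * ((K ^ 30)⁻¹ * C₃ * geomConst ε₀ ((747 : ℝ) / 100)) * (1 + ε₀) ^ ((496 : ℝ) / 100 * k) := by
    have hm : ∫ s in (τ (n₀ - N))..t, (Xr 0 1 s ^ 2 + W 0 1 s ^ 2) ≤ ∫ s in (τ (n₀ - N))..t, 2 * Er 1 s :=
      integral_mono_on hτt hi1 (((h.continuousOn_E 1 le_rfl).mono
        (Icc_subset_Icc le_rfl (htk.trans hk0'))).intervalIntegrable_of_Icc hτt |>.const_mul 2)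
        fun s hs => h.sq_add_sqW_le_two_mul_energy 0 0 1 hs.1
    have hm2 : ∫ s in (τ (n₀ - N))..t, 2 * Er 1 s ≤ ∫ s in (τ (n₀ - N))..(τ k), 2 * Er 1 s := by
      apply integral_mono_interval le_rfl hτt htk
      · exact ae_restrict_of_forall_mem measurableSet_Ioc fun s hs => by
          have := h.nonneg_F 1 s hs.1.le; positivity
      · exact ((h.continuousOn_E 1 le_rfl).mono
          (Icc_subset_Icc le_rfl hk0')).intervalIntegrable_of_Icc hτk |>.const_mul 2
    have hm3 := h.integral_energy_one_past_le hε₀ hKpos hC₃ (k := k) (by omega) hk0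
    simp only [intervalIntegral.integral_const_mul] at hm hm2
    have hdec : (1 + ε₀) ^ ((747 : ℝ) / 100 * k) ≤ (1 + ε₀) ^ ((496 : ℝ) / 100 * k) := by
      apply Real.rpow_le_rpow_of_exponent_le h1
      have : (k : ℝ) ≤ 0 := by exact_mod_cast hk0
      nlinarith
    have hG : 0 ≤ (K ^ 30)⁻¹ * C₃ * geomConst ε₀ ((747 : ℝ) / 100) := by
      have := geomConst_pos hε₀ (s := (747 : ℝ) / 100) (by norm_num); positivity
    have hstep : (K ^ 30)⁻¹ * C₃ * geomConst ε₀ ((747 : ℝ) / 100) * (1 + ε₀) ^ ((747 : ℝ) / 100 * k) ≤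
        (K ^ 30)⁻¹ * C₃ * geomConst ε₀ ((747 : ℝ) / 100) * (1 + ε₀) ^ ((496 : ℝ) / 100 * k) :=
      mul_le_mul_of_nonneg_left hdec hG
    calc ∫ s in (τ (n₀ - N))..t, (Xr 0 1 s ^ 2 + W 0 1 s ^ 2)
        ≤ 2 * ∫ s in (τ (n₀ - N))..(τ k), Er 1 s := hm.trans hm2
      _ ≤ 2 * ((K ^ 30)⁻¹ * C₃ * geomConst ε₀ ((747 : ℝ) / 100) * (1 + ε₀) ^ ((747 : ℝ) / 100 * k)) :=
          by linarith
      _ ≤ 2 * ((K ^ 30)⁻¹ * C₃ * geomConst ε₀ ((747 : ℝ) / 100) * (1 + ε₀) ^ ((496 : ℝ) / 100 * k)) :=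
          by linarith
      _ = _ := by ring
  -- second piece: `∫ √Ẽ₁ ≤ Ξ C₃ G_{4.96} q^{(496/100)k}` from the improved decay
  have hP2 : ∫ s in (τ (n₀ - N))..t, Real.sqrt (Er 1 s) ≤
      Ξ * C₃ * geomConst ε₀ ((496 : ℝ) / 100) * (1 + ε₀) ^ ((496 : ℝ) / 100 * k) := by
    have hm2 : ∫ s in (τ (n₀ - N))..t, Real.sqrt (Er 1 s) ≤ ∫ s in (τ (n₀ - N))..(τ k), Real.sqrt (Er 1 s) := by
      apply integral_mono_interval le_rfl hτt htk
      · exact ae_restrict_of_forall_mem measurableSet_Ioc fun s _ => Real.sqrt_nonneg _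
      · exact (hc2.mono (Icc_subset_Icc le_rfl le_rfl)).intervalIntegrable_of_Icc hτk
    have hm3 := h.integral_past_le hε₀ hC₃ ((h.continuousOn_E 1 le_rfl).sqrt) (D := Ξ)
      (s := (496 : ℝ) / 100) hΞ0 (by norm_num) (fun j hj hj0 s hs => by
        have := h.sqrt_energy_one_past_le_improved hε₀ hε₀1 hK hC₃ hκ hj hj0 hs
        convert this using 2; norm_num) (k := k) (by omega) hk0
    exact hm2.trans hm3
  have hA0 : 0 ≤ (1 + ε₀) ^ ((5 : ℝ) / 2) * ε ^ 2 * Real.exp (-K ^ 10) := by positivity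
  have hB0 : 0 ≤ 4 * C₁ * (1 + ε₀) ^ (-(n₀ : ℝ) / 2) := by positivity
  have hG1 : 0 ≤ (K ^ 30)⁻¹ * C₃ * geomConst ε₀ ((747 : ℝ) / 100) * (1 + ε₀) ^ ((496 : ℝ) / 100 * k) := by
    have := geomConst_pos hε₀ (s := (747 : ℝ) / 100) (by norm_num); positivity
  calc (1 + ε₀) ^ ((5 : ℝ) / 2) * ε ^ 2 * Real.exp (-K ^ 10) *
          (∫ s in (τ (n₀ - N))..t, (Xr 0 1 s ^ 2 + W 0 1 s ^ 2)) +
        4 * C₁ * (1 + ε₀) ^ (-(n₀ : ℝ) / 2) * (∫ s in (τ (n₀ - N))..t, Real.sqrt (Er 1 s))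
      ≤ (1 + ε₀) ^ ((5 : ℝ) / 2) * ε ^ 2 * Real.exp (-K ^ 10) *
          (2 * ((K ^ 30)⁻¹ * C₃ * geomConst ε₀ ((747 : ℝ) / 100)) * (1 + ε₀) ^ ((496 : ℝ) / 100 * k)) +
        4 * C₁ * (1 + ε₀) ^ (-(n₀ : ℝ) / 2) *
          (Ξ * C₃ * geomConst ε₀ ((496 : ℝ) / 100) * (1 + ε₀) ^ ((496 : ℝ) / 100 * k)) :=
        add_le_add (mul_le_mul_of_nonneg_left hP1 hA0) (mul_le_mul_of_nonneg_left hP2 hB0)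
    _ ≤ 6 * ε ^ 2 * Real.exp (-K ^ 10) *
          (2 * ((K ^ 30)⁻¹ * C₃ * geomConst ε₀ ((747 : ℝ) / 100)) * (1 + ε₀) ^ ((496 : ℝ) / 100 * k)) +
        4 * C₁ * (1 + ε₀) ^ (-(n₀ : ℝ) / 2) *
          (Ξ * C₃ * geomConst ε₀ ((496 : ℝ) / 100) * (1 + ε₀) ^ ((496 : ℝ) / 100 * k)) := by
        gcongr
        have := geomConst_pos hε₀ (s := (747 : ℝ) / 100) (by norm_num)
        positivity
    _ = _ := by simp only [hΞ]; ring

/-- **The source integral on the present** `[0, T]`, `T ≤ 100`: if `Ẽ₁ ≤ 1` on `[0, T]` and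
`∫_0^T a₁² ≤ P` (this is (6.86), `P = K^{-1/4}`), then for `t ∈ [0, T]`,
`∫_{τ₀}^t R ≤ (A_c + B_c) + 6 ε² e^{-K^{10}} P + 400 C₁ (1+ε₀)^{-n₀/2}`.
[cite: Tao2016AveragedNS, §6.6 Prop. 6.13 (6.86), (6.122)] -/
theorem RescaledSplitHypotheses.integral_source_one_present_le
    (h : RescaledSplitHypotheses γ ε₀ K ε C₁ C₂ C₃ n₀ N ηp βp τ Xr W Er) (hε₀ : 0 < ε₀) (hε₀1 : ε₀ < 1)
    (hK : 1 ≤ K) (hε : 0 < ε) (hC₁ : 0 ≤ C₁) (hC₃ : 0 ≤ C₃) (hN : n₀ ≤ N)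
    (hκ : 36 * Real.sqrt 2 * K * ((K ^ 15)⁻¹ * (1 + ε₀) ^ (-(999 : ℝ) / 100) * C₃ *
      geomConst ε₀ ((248 : ℝ) / 100)) ≤ 1)
    {T P : ℝ} (hT : T ≤ 100) (hE1 : ∀ t ∈ Icc 0 T, Er 1 t ≤ 1)
    (hP : ∫ s in (0 : ℝ)..T, (Xr 0 1 s ^ 2 + W 0 1 s ^ 2) ≤ P) {t : ℝ} (ht : t ∈ Icc 0 T) :
    ∫ s in (τ (n₀ - N))..t, ((1 + ε₀) ^ ((5 : ℝ) / 2) * ε ^ 2 * Real.exp (-K ^ 10) * (Xr 0 1 s ^ 2 + W 0 1 s ^ 2) +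
        4 * C₁ * (1 + ε₀) ^ (-(n₀ : ℝ) / 2) * Real.sqrt (Er 1 s)) ≤
      (12 * ε ^ 2 * Real.exp (-K ^ 10) * ((K ^ 30)⁻¹ * C₃ * geomConst ε₀ ((747 : ℝ) / 100)) +
        4 * C₁ * (1 + ε₀) ^ (-(n₀ : ℝ) / 2) *
          (Real.exp 1 * (6 * Real.sqrt 2 * K) * cumEnergyConst ε₀ C₃ * C₃ *
            geomConst ε₀ ((496 : ℝ) / 100))) +
      6 * ε ^ 2 * Real.exp (-K ^ 10) * P + 400 * C₁ * (1 + ε₀) ^ (-(n₀ : ℝ) / 2) := by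
  have h0 : (0 : ℝ) < 1 + ε₀ := by linarith
  have hq6 : (1 + ε₀) ^ ((5 : ℝ) / 2) ≤ 6 := rpow_five_halves_le_six h0.le (by linarith)
  have hτ00 : (τ (n₀ - N)) ≤ 0 := h.tau_init_le hN
  have hT0 : 0 ≤ T := ht.1.trans ht.2
  set R : ℝ → ℝ := fun s => (1 + ε₀) ^ ((5 : ℝ) / 2) * ε ^ 2 * Real.exp (-K ^ 10) * (Xr 0 1 s ^ 2 + W 0 1 s ^ 2) +
      4 * C₁ * (1 + ε₀) ^ (-(n₀ : ℝ) / 2) * Real.sqrt (Er 1 s) with hR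
  have hRc : ContinuousOn R (Icc (τ (n₀ - N)) T) := h.continuousOn_source_one le_rfl
  have hRi : ∀ {x y : ℝ}, (τ (n₀ - N)) ≤ x → x ≤ y → y ≤ T → IntervalIntegrable R volume x y :=
    fun hx hxy hy => (hRc.mono (Icc_subset_Icc hx hy)).intervalIntegrable_of_Icc hxy
  -- split at `0`
  rw [← integral_add_adjacent_intervals (hRi le_rfl hτ00 hT0) (hRi hτ00 ht.1 (ht.2))]
  -- past part: the `k = 0` case of the past bound (or an empty past if `N = n₀`)
  have hpast : ∫ s in (τ (n₀ - N))..(0 : ℝ), R s ≤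
      12 * ε ^ 2 * Real.exp (-K ^ 10) * ((K ^ 30)⁻¹ * C₃ * geomConst ε₀ ((747 : ℝ) / 100)) +
        4 * C₁ * (1 + ε₀) ^ (-(n₀ : ℝ) / 2) *
          (Real.exp 1 * (6 * Real.sqrt 2 * K) * cumEnergyConst ε₀ C₃ * C₃ *
            geomConst ε₀ ((496 : ℝ) / 100)) := by
    rcases eq_or_lt_of_le hN with heq | hlt
    · -- empty past
      have hτz : τ (n₀ - N) = 0 := by rw [heq, sub_self, h.tau_zero]
      rw [hτz, intervalIntegral.integral_same]
      have hG1 := geomConst_pos hε₀ (s := (747 : ℝ) / 100) (by norm_num)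
      have hG2 := geomConst_pos hε₀ (s := (496 : ℝ) / 100) (by norm_num)
      have hcum := cumEnergyConst_nonneg hε₀ hC₃
      have hKpos : 0 < K := by linarith
      positivity
    · have hmem : (0 : ℝ) ∈ Icc (τ (0 - 1)) (τ 0) := by
        refine ⟨?_, by rw [h.tau_zero]⟩
        have := h.tau_lt 0 (by omega) le_rfl
        rw [h.tau_zero] at this
        exact this.le
      have hp := h.integral_source_one_past_le hε₀ hε₀1 hK hε hC₁ hC₃ hκ (k := 0) (by omega) le_rfl
        hmem
      simpa only [Int.cast_zero, mul_zero, Real.rpow_zero, mul_one] using hp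
  -- present part: `∫_0^t R ≤ 6 ε² E P + 400 C₁ δ`
  have hc1 : ContinuousOn (fun s => Xr 0 1 s ^ 2 + W 0 1 s ^ 2) (Icc 0 T) :=
    ((h.continuousOn_X 0 1 hτ00).pow 2).add ((h.continuousOn_W 0 1 hτ00).pow 2)
  have hc2 : ContinuousOn (fun s => Real.sqrt (Er 1 s)) (Icc 0 T) := (h.continuousOn_E 1 hτ00).sqrt
  have hi1 : IntervalIntegrable (fun s => Xr 0 1 s ^ 2 + W 0 1 s ^ 2) volume 0 t :=
    (hc1.mono (Icc_subset_Icc le_rfl ht.2)).intervalIntegrable_of_Icc ht.1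
  have hi2 : IntervalIntegrable (fun s => Real.sqrt (Er 1 s)) volume 0 t :=
    (hc2.mono (Icc_subset_Icc le_rfl ht.2)).intervalIntegrable_of_Icc ht.1
  have hpres : ∫ s in (0 : ℝ)..t, R s ≤ 6 * ε ^ 2 * Real.exp (-K ^ 10) * P +
      400 * C₁ * (1 + ε₀) ^ (-(n₀ : ℝ) / 2) := by
    simp only [hR]
    rw [intervalIntegral.integral_add (hi1.const_mul _) (hi2.const_mul _),
      intervalIntegral.integral_const_mul, intervalIntegral.integral_const_mul]
    have hP1 : ∫ s in (0 : ℝ)..t, (Xr 0 1 s ^ 2 + W 0 1 s ^ 2) ≤ P := by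
      refine le_trans ?_ hP
      apply integral_mono_interval le_rfl ht.1 ht.2
      · exact ae_restrict_of_forall_mem measurableSet_Ioc fun s _ => by positivity
      · exact hc1.intervalIntegrable_of_Icc hT0
    have hP2 : ∫ s in (0 : ℝ)..t, Real.sqrt (Er 1 s) ≤ 100 := by
      have hm : ∫ s in (0 : ℝ)..t, Real.sqrt (Er 1 s) ≤ ∫ s in (0 : ℝ)..t, (1 : ℝ) := by
        apply integral_mono_on ht.1 hi2 intervalIntegrable_const
        intro s hs
        have := hE1 s ⟨hs.1, hs.2.trans ht.2⟩
        calc Real.sqrt (Er 1 s) ≤ Real.sqrt 1 := Real.sqrt_le_sqrt this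
          _ = 1 := Real.sqrt_one
      rw [intervalIntegral.integral_const, smul_eq_mul, mul_one] at hm
      linarith [ht.2]
    have hA0 : 0 ≤ (1 + ε₀) ^ ((5 : ℝ) / 2) * ε ^ 2 * Real.exp (-K ^ 10) := by positivity
    have hB0 : 0 ≤ 4 * C₁ * (1 + ε₀) ^ (-(n₀ : ℝ) / 2) := by positivity
    have hPnn : 0 ≤ P := le_trans (integral_nonneg hT0 fun s _ => by positivity) hP
    calc (1 + ε₀) ^ ((5 : ℝ) / 2) * ε ^ 2 * Real.exp (-K ^ 10) *
          (∫ s in (0 : ℝ)..t, (Xr 0 1 s ^ 2 + W 0 1 s ^ 2)) +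
          4 * C₁ * (1 + ε₀) ^ (-(n₀ : ℝ) / 2) * (∫ s in (0 : ℝ)..t, Real.sqrt (Er 1 s))
        ≤ (1 + ε₀) ^ ((5 : ℝ) / 2) * ε ^ 2 * Real.exp (-K ^ 10) * P +
            4 * C₁ * (1 + ε₀) ^ (-(n₀ : ℝ) / 2) * 100 :=
          add_le_add (mul_le_mul_of_nonneg_left hP1 hA0) (mul_le_mul_of_nonneg_left hP2 hB0)
      _ ≤ 6 * ε ^ 2 * Real.exp (-K ^ 10) * P + 4 * C₁ * (1 + ε₀) ^ (-(n₀ : ℝ) / 2) * 100 := by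
          gcongr
      _ = _ := by ring
  have hpres' : ∫ s in (0 : ℝ)..t, ((1 + ε₀) ^ ((5 : ℝ) / 2) * ε ^ 2 * Real.exp (-K ^ 10) * (Xr 0 1 s ^ 2 + W 0 1 s ^ 2) +
      4 * C₁ * (1 + ε₀) ^ (-(n₀ : ℝ) / 2) * Real.sqrt (Er 1 s)) ≤ 6 * ε ^ 2 * Real.exp (-K ^ 10) * P +
      400 * C₁ * (1 + ε₀) ^ (-(n₀ : ℝ) / 2) := hpres
  have hpast' : ∫ s in (τ (n₀ - N))..(0 : ℝ), ((1 + ε₀) ^ ((5 : ℝ) / 2) * ε ^ 2 * Real.exp (-K ^ 10) *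
      (Xr 0 1 s ^ 2 + W 0 1 s ^ 2) + 4 * C₁ * (1 + ε₀) ^ (-(n₀ : ℝ) / 2) * Real.sqrt (Er 1 s)) ≤
      12 * ε ^ 2 * Real.exp (-K ^ 10) * ((K ^ 30)⁻¹ * C₃ * geomConst ε₀ ((747 : ℝ) / 100)) +
        4 * C₁ * (1 + ε₀) ^ (-(n₀ : ℝ) / 2) *
          (Real.exp 1 * (6 * Real.sqrt 2 * K) * cumEnergyConst ε₀ C₃ * C₃ *
            geomConst ε₀ ((496 : ℝ) / 100)) := hpast
  linarith

/-! ## (6.91): the one-sided lower bound on `c₁` -/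

/-- **(6.91): `c₁ ≥ -O((1+ε₀)^{-n₀/2})`.** Under the bootstrap bound `Λ ≤ ε/100` on `[τ₀, T]`, for
`t ∈ [τ₀, T]`: `c₁(t) ≥ -exp((6/100)K^{10}) · 4C₁(1+ε₀)^{-n₀/2} ∫_{τ₀}^t Ẽ₁^{1/2}` (the nonnegative part `(1+ε₀)^{5/2}ε²e^{-K^{10}}ã₁²` of the split seed `ε²e^{-K¹⁰}(ã₁² - Z̃²_{a,1})` is discarded; its NEGATIVE
part `-(1+ε₀)^{5/2}ε²e^{-K¹⁰}Z̃²_{a,1}` joins the source — the one place of Prop. 6.13 where the split seed's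
indefinite sign matters: the integral `∫ Z̃²_{a,1}` over the past must be supplied `n₀`-small by a
past-asymmetry lemma for the fresh shell). [cite: Tao2016AveragedNS, §6.6 Prop. 6.13 (6.91), (6.124)] -/
theorem RescaledSplitHypotheses.c_one_ge_neg
    (h : RescaledSplitHypotheses γ ε₀ K ε C₁ C₂ C₃ n₀ N ηp βp τ Xr W Er) (hε₀ : 0 < ε₀) (hε₀1 : ε₀ < 1)
    (hε : 0 < ε) (hC₁ : 0 ≤ C₁) (hN : n₀ ≤ N) {T : ℝ}
    (hΛ : ∀ t ∈ Icc (τ (n₀ - N)) T, ∫ s in (τ (n₀ - N))..t, |Xr 1 1 s| ≤ ε / 100)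
    {t : ℝ} (ht : t ∈ Icc (τ (n₀ - N)) T) :
    -(Real.exp (6 / 100 * K ^ 10) *
      ∫ s in (τ (n₀ - N))..t, (4 * C₁ * (1 + ε₀) ^ (-(n₀ : ℝ) / 2) * Real.sqrt (Er 1 s) +
        (1 + ε₀) ^ ((5 : ℝ) / 2) * ε ^ 2 * Real.exp (-K ^ 10) * W 0 1 s ^ 2)) ≤ Xr 2 1 t := by
  have h0 : (0 : ℝ) < 1 + ε₀ := by linarith
  have hq6 : (1 + ε₀) ^ ((5 : ℝ) / 2) ≤ 6 := rpow_five_halves_le_six h0.le (by linarith)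
  set β : ℝ → ℝ := fun s => (1 + ε₀) ^ ((5 : ℝ) / 2) * ε⁻¹ * K ^ 10 * Xr 1 1 s with hβ
  set A : ℝ → ℝ := fun s => 4 * C₁ * (1 + ε₀) ^ (-(n₀ : ℝ) / 2) * Real.sqrt (Er 1 s) +
      (1 + ε₀) ^ ((5 : ℝ) / 2) * ε ^ 2 * Real.exp (-K ^ 10) * W 0 1 s ^ 2 with hA
  have hβc : ContinuousOn β (Icc (τ (n₀ - N)) T) := continuousOn_const.mul (h.continuousOn_X 1 1 le_rfl)
  have hAc : ContinuousOn A (Icc (τ (n₀ - N)) T) :=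
    (continuousOn_const.mul (h.continuousOn_E 1 le_rfl).sqrt).add
      (continuousOn_const.mul ((h.continuousOn_W 0 1 le_rfl).pow 2))
  have hA0 : ∀ s ∈ Icc (τ (n₀ - N)) T, 0 ≤ A s := fun s hs => by simp only [hA]; positivity
  have hbound : ∀ s ∈ Ico (τ (n₀ - N)) T, β s * Xr 2 1 s - A s ≤ derivWithin (Xr 2 1) (Ici (τ (n₀ - N))) s := by
    intro s hs
    have hE := (abs_le.1 (h.eq_c_one_delta hε₀ hε₀1.le hC₁ hs.1)).1
    have hsrc : 0 ≤ (1 + ε₀) ^ ((5 : ℝ) / 2) * (ε ^ 2 * Real.exp (-K ^ 10) * Xr 0 1 s ^ 2) := by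
      positivity
    have hid : (1 + ε₀) ^ ((5 : ℝ) / 2) *
        (ε ^ 2 * Real.exp (-K ^ 10) * Xr 0 1 s ^ 2 + ε⁻¹ * K ^ 10 * Xr 1 1 s * Xr 2 1 s -
          ε ^ 2 * Real.exp (-K ^ 10) * W 0 1 s ^ 2) =
        (1 + ε₀) ^ ((5 : ℝ) / 2) * (ε ^ 2 * Real.exp (-K ^ 10) * Xr 0 1 s ^ 2) + β s * Xr 2 1 s -
          (1 + ε₀) ^ ((5 : ℝ) / 2) * ε ^ 2 * Real.exp (-K ^ 10) * W 0 1 s ^ 2 := by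
      simp only [hβ]; ring
    rw [hid] at hE
    simp only [hA]
    linarith
  have hinit : 0 ≤ Xr 2 1 (τ (n₀ - N)) := (h.init_Y 2 1 (by omega)).symm.le
  have hmain := ge_neg_of_deriv_ge_linear (h.continuousOn_X 2 1 le_rfl)
    (fun s hs => h.hasDeriv_X 2 1 hs.1) hAc hA0 hβc hbound hinit ht
  -- bound the exponential factor
  have hexp : Real.exp (∫ s in (τ (n₀ - N))..t, |β s|) ≤ Real.exp (6 / 100 * K ^ 10) := by
    apply Real.exp_le_exp.2
    have hI : ∫ s in (τ (n₀ - N))..t, |β s| =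
        (1 + ε₀) ^ ((5 : ℝ) / 2) * ε⁻¹ * K ^ 10 * ∫ s in (τ (n₀ - N))..t, |Xr 1 1 s| :=
      integral_abs_rate_eq K hε₀ hε (Xr 1 1) (τ (n₀ - N)) t
    rw [hI]
    have hΛt := hΛ t ht
    calc (1 + ε₀) ^ ((5 : ℝ) / 2) * ε⁻¹ * K ^ 10 * ∫ s in (τ (n₀ - N))..t, |Xr 1 1 s|
        ≤ (1 + ε₀) ^ ((5 : ℝ) / 2) * ε⁻¹ * K ^ 10 * (ε / 100) :=
          mul_le_mul_of_nonneg_left hΛt (by positivity)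
      _ = (1 + ε₀) ^ ((5 : ℝ) / 2) * K ^ 10 / 100 := by field_simp
      _ ≤ 6 * K ^ 10 / 100 := by gcongr
      _ = 6 / 100 * K ^ 10 := by ring
  have hint0 : 0 ≤ ∫ s in (τ (n₀ - N))..t, A s := integral_nonneg ht.1 fun s hs => hA0 s ⟨hs.1, hs.2.trans ht.2⟩
  have := mul_le_mul_of_nonneg_right hexp hint0
  simp only [hA] at this hmain ⊢
  linarith

end ScaleOne

end Tao2016AveragedNS

end Literature.Analysis.FluidPDE
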